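import Summits.HodgeConjecture.HodgeConjecture.Theses.EndoscopicMiddleDegree
import Summits.HodgeConjecture.HodgeConjecture.Theorems.BoundaryReadoutPullbackAlgebraic
import Literature.AlgebraicGeometry.HodgeTheory.AlgebraicClassesExteriorProduct
import Literature.AlgebraicGeometry.HodgeTheory.MotivatedClassesAssembly
import Literature.AlgebraicGeometry.Motives.SegreEmbedding
import HarnessLib

/-!
# `CupProductAlgebraic` (stmt-HodgeConjecture-14350) — PROVED: cup products of algebraic classes are
# algebraic, `Nˡ H²ˡ ∪ Nᵏ H²ᵏ ⊆ Nˡ⁺ᵏ H²ˡ⁺²ᵏ`, on every smooth projective complex variety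

Route `EndoscopicMiddleDegree` of `HodgeConjecture`, support item `CupProductAlgebraic`
(stmt-HodgeConjecture-14350; Voisin II Prop. 9.20, Fulton §19.2): a by-product of the crux
`PullbackAlgebraic` (stmt-HodgeConjecture-1071), proved in `Theorems/BoundaryReadoutPullbackAlgebraic`
(`fulton1998_map_mem_algebraicClasses_holds`: pull-back along any `ℂ`-morphism of smooth projective
varieties preserves `Nᵖ H²ᵖ`). Indeed `a ∪ b = Δ^*(pr₁^* a ∪ pr₂^* b)` and the exterior product of
algebraic classes is algebraic (the tree's `cupProduct_mem_algebraicClasses_of_forall_map_diagonal`,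
file `HodgeTheory/AlgebraicClassesExteriorProduct`), so pull-back along the diagonal
`Δ = (𝟙, 𝟙) : V ⟶ V ⊗ V` (a morphism of smooth projective varieties, `IsSmoothProjective.tensor_holds`)
finishes.

* `Voisin2003_cupProduct_algebraicClasses_holds` — the tree's NAMED FACT
  `HodgeTheory.Voisin2003_cupProduct_algebraicClasses` (file `HodgeTheory/MotivatedClassesAssembly`),
  now a THEOREM;
* `endoscopicMiddleDegree_cupProductAlgebraic_proof` — the route decl
  `EndoscopicMiddleDegree.CupProductAlgebraic`.

## References

* [VoisinHodgeII2003] C. Voisin, Hodge Theory and Complex Algebraic Geometry II (2003), Prop. 9.20,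
  Prop. 9.21 (i).
* [Fulton1998] W. Fulton, Intersection Theory, 2nd ed. (1998), §19.2 Cor. 19.2 (b), Example 8.1.1.
-/

noncomputable section

-- `Summit.HodgeConjecture.HodgeConjecture.…` is the mandated namespace (single-conjunct summit).
set_option linter.dupNamespace false

namespace Summit.HodgeConjecture.HodgeConjecture.Theorems

open CategoryTheory MonoidalCategory CartesianMonoidalCategory
open Literature.AlgebraicGeometry Literature.AlgebraicGeometry.Motives Literature.AlgebraicGeometry.HodgeTheory
open Literature.AlgebraicTopology.SingularHomology (cupProduct)

/-- **Cup products of algebraic classes are algebraic** — the tree's named fact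
`Voisin2003_cupProduct_algebraicClasses`, PROVED: on a smooth projective complex `V`,
`x ∈ Nᵃ H²ᵃ`, `y ∈ Nᵇ H²ᵇ ⟹ x ∪ y ∈ Nᵃ⁺ᵇ H²ᵃ⁺²ᵇ` (diagonal pull-back of the exterior product,
`cupProduct_mem_algebraicClasses_of_forall_map_diagonal`, fed with the proved pull-back theorem
`fulton1998_map_mem_algebraicClasses_holds` for `Δ : V ⟶ V ⊗ V`).
[cite: VoisinHodgeII2003, Prop. 9.20 and Prop. 9.21 (i)] [cite: Fulton1998, §19.2 Cor. 19.2 (b)] -/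
theorem Voisin2003_cupProduct_algebraicClasses_holds : Voisin2003_cupProduct_algebraicClasses :=
  fun _ _ hV a b _ _ hx hy ↦
    cupProduct_mem_algebraicClasses_of_forall_map_diagonal
      (fun _ _ hW p _ hc ↦ fulton1998_map_mem_algebraicClasses_holds (lift (𝟙 _) (𝟙 _))
        (IsSmoothProjective.tensor_holds hW hW) hW p _ hc)
      hV a b hx hy

/-- **The support item `CupProductAlgebraic` of route `EndoscopicMiddleDegree`**
(stmt-HodgeConjecture-14350): on a smooth projective complex `X`, `a ∈ Nˡ H²ˡ(X)`, `b ∈ Nᵏ H²ᵏ(X)`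
imply `a ∪ b ∈ Nˡ⁺ᵏ H²ˡ⁺²ᵏ(X)`. [cite: VoisinHodgeII2003, Prop. 9.20] [cite: Fulton1998, §19.2 Cor. 19.2 (b)] -/
theorem endoscopicMiddleDegree_cupProductAlgebraic_proof :
    (Summit.HodgeConjecture.HodgeConjecture.Theses.EndoscopicMiddleDegree.CupProductAlgebraic : Prop) :=
  fun _ _ hX _ _ _ _ ha hb ↦ Voisin2003_cupProduct_algebraicClasses_holds hX ha hb

end Summit.HodgeConjecture.HodgeConjecture.Theorems

end
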